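import Summits.NavierStokesRegularity.FunctionalMining.NoGo.LogThresholdSupNorm
import Summits.NavierStokesRegularity.FunctionalMining.NoGo.LogDoorWitness
import Mathlib.MeasureTheory.Measure.Haar.NormedSpace
import HarnessLib

/-!
# The log-door packet `W_K`: explicit-in-`(r, K)` profile bounds and `∫‖∇ΔW_K‖²`

Search for candidate a priori estimates; no regularity claim. NS FUNCTIONAL MINING — NO-GO BRANCH
(cell `pub-nsfunc`, prove seat gen 4). Quantitative companions of `NoGo/LogDoorOscillation.lean`
and `NoGo/LogDoorPacket.lean` for the log-door threshold:
* `abs_iteratedDeriv_bumpR_le`: `|a_r⁽ⁱ⁾| ≤ Āᵢ / rⁱ` for `a_r = bumpA(·/r)` (explicit `r`-dependence);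
* `Sq_bumpR_zero`: `∫ a_r² = r ∫ bumpA²` (exact scaling), `Sq_bumpA_zero_pos`;
* `iteratedDeriv_gK_four`, `abs_iteratedDeriv_gK_three_le`, `abs_iteratedDeriv_gK_four_le`:
  the fourth derivative of the packet profile `g_K = K⁻² a cos(K·)` and polynomial-in-`K` bounds;
* `packet_gradLaplacianNormSq_le`: for ANY smooth profile triple vanishing off `[-2,2]` with
  `|sep φ i j k| ≤ 𝒮` (`i, j ≤ 4`, `k ≤ 3`): `∫ Σₘ ‖∂ₘΔ(packet φ)‖² ≤ 486 𝒮² |B̄(0,4)|`.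
Folklore calculus; nothing is asserted about Navier–Stokes.
-/

noncomputable section

open MeasureTheory Set Function Filter Real
open scoped ContDiff Topology Laplacian InnerProductSpace RealInnerProductSpace

namespace Summit.NavierStokesRegularity.FunctionalMining

namespace Sep3

open Literature.Analysis.FluidPDE LogDoor

/-- `k ≤ ∞` in `WithTop ℕ∞` for a natural number `k`. [folklore] -/
private theorem natCast_le_inftyP (k : ℕ) : (k : WithTop ℕ∞) ≤ ∞ := by exact_mod_cast le_top

/-! ## The radial profile `a_r = bumpA(·/r)` -/

/-- `a_r = bumpA ∘ (r⁻¹ ·)`. [folklore] -/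
theorem bumpR_eq_comp (r : ℝ) : bumpR r = fun t => bumpA (r⁻¹ * t) :=
  funext fun t => by rw [bumpR, div_eq_inv_mul]

/-- `a_r⁽ⁱ⁾(t) = r⁻ⁱ bumpA⁽ⁱ⁾(t/r)`. [folklore] -/
theorem iteratedDeriv_bumpR (r : ℝ) (i : ℕ) (t : ℝ) :
    iteratedDeriv i (bumpR r) t = (r⁻¹) ^ i * iteratedDeriv i bumpA (r⁻¹ * t) := by
  rw [bumpR_eq_comp, iteratedDeriv_comp_const_mul (bumpA.contDiff.of_le (natCast_le_inftyP i))]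

/-- **`|a_r⁽ⁱ⁾| ≤ Āᵢ / rⁱ`** from `|bumpA⁽ⁱ⁾| ≤ Āᵢ`, `r > 0`. [folklore] -/
theorem abs_iteratedDeriv_bumpR_le {r : ℝ} (hr : 0 < r) {i : ℕ} {A : ℝ}
    (hA : ∀ t, |iteratedDeriv i bumpA t| ≤ A) (t : ℝ) : |iteratedDeriv i (bumpR r) t| ≤ A / r ^ i := by
  rw [iteratedDeriv_bumpR, abs_mul, abs_pow, abs_inv, abs_of_pos hr, inv_pow, div_eq_inv_mul]
  exact mul_le_mul_of_nonneg_left (hA _) (by positivity)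

/-- `∫ a_r² = r · ∫ bumpA²`. [folklore] -/
theorem Sq_bumpR_zero {r : ℝ} (hr : 0 < r) : Sq (bumpR r) 0 = r * Sq bumpA 0 := by
  simp only [Sq, iteratedDeriv_zero]
  have h := MeasureTheory.Measure.integral_comp_div (fun t => bumpA t ^ 2) r
  simp only [bumpR] at h ⊢
  rw [h, abs_of_pos hr, smul_eq_mul]

/-- `∫ bumpA² > 0`. [folklore] -/
theorem Sq_bumpA_zero_pos : 0 < Sq bumpA 0 := by
  rw [Sq]
  refine (bumpA.contDiff.continuous_iteratedDeriv 0 (by exact_mod_cast le_top)).pow 2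
    |>.integral_pos_of_hasCompactSupport_nonneg_nonzero ?_ (fun t => sq_nonneg _) (x := 0) ?_
  · exact HasCompactSupport.intro (isCompact_Icc (a := (-2 : ℝ)) (b := 2)) fun t ht => by
      simp [iteratedDeriv_eq_zero_of_abs_lt bumpA.zero 0 t (two_lt_abs_of_not_mem_Icc ht)]
  · simp [iteratedDeriv_zero, bumpA.eq_one (show |(0 : ℝ)| ≤ 1 by simp)]

/-- `Sq f l ≤ 4C²` for a smooth `f` vanishing off `[-2,2]` with `|f⁽ˡ⁾| ≤ C`. [folklore] -/
theorem Sq_le_of_abs_le {f : ℝ → ℝ} (hf : ContDiff ℝ ∞ f) (h0 : ∀ t, 2 < |t| → f t = 0) (l : ℕ)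
    {C : ℝ} (hC : ∀ t, |iteratedDeriv l f t| ≤ C) : Sq f l ≤ 4 * C ^ 2 :=
  integral_sq_le_of_abs_le (hf.continuous_iteratedDeriv l (by exact_mod_cast le_top))
    (iteratedDeriv_eq_zero_of_abs_lt h0 l) hC

/-! ## The packet profile `g_K`: third and fourth derivatives, polynomial bounds -/

section GK

variable {φ : ℝ → ℝ} {K : ℝ}

/-- `g_K'''' = (K²)⁻¹ (φ'''' − 6K²φ'' + K⁴φ) cos(K·) + (K²)⁻¹ (4K³φ' − 4Kφ''') sin(K·)`. [folklore] -/
theorem iteratedDeriv_gK_four (hφ : ContDiff ℝ ∞ φ) (K : ℝ) :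
    iteratedDeriv 4 (gK φ K) = fun t =>
      (K ^ 2)⁻¹ * (iteratedDeriv 4 φ t - 6 * K ^ 2 * iteratedDeriv 2 φ t + K ^ 4 * iteratedDeriv 0 φ t) *
          cos (K * t) +
        (K ^ 2)⁻¹ * (4 * K ^ 3 * iteratedDeriv 1 φ t - 4 * K * iteratedDeriv 3 φ t) * sin (K * t) := by
  rw [iteratedDeriv_succ, iteratedDeriv_gK_three hφ]
  funext t
  have hA : HasDerivAt (fun s => (K ^ 2)⁻¹ * (iteratedDeriv 3 φ s - 3 * K ^ 2 * iteratedDeriv 1 φ s))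
      ((K ^ 2)⁻¹ * (iteratedDeriv 4 φ t - 3 * K ^ 2 * iteratedDeriv 2 φ t)) t :=
    ((hasDerivAt_iteratedDeriv hφ 3 t).sub ((hasDerivAt_iteratedDeriv hφ 1 t).const_mul _)).const_mul _
  have hB : HasDerivAt (fun s => (K ^ 2)⁻¹ * (K ^ 3 * iteratedDeriv 0 φ s - 3 * K * iteratedDeriv 2 φ s))
      ((K ^ 2)⁻¹ * (K ^ 3 * iteratedDeriv 1 φ t - 3 * K * iteratedDeriv 3 φ t)) t :=
    (((hasDerivAt_iteratedDeriv hφ 0 t).const_mul _).sub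
      ((hasDerivAt_iteratedDeriv hφ 2 t).const_mul _)).const_mul _
  rw [(hasDerivAt_cos_sin K t hA hB).deriv]
  ring

/-- `|g_K'''| ≤ K Φ₀ + Φ₃ + 3Φ₁ + 3Φ₂` for `K ≥ 1`. [folklore] -/
theorem abs_iteratedDeriv_gK_three_le (hφ : ContDiff ℝ ∞ φ) (hK : 1 ≤ K) {Φ₀ Φ₁ Φ₂ Φ₃ : ℝ}
    (hΦ₀ : ∀ t, |iteratedDeriv 0 φ t| ≤ Φ₀) (hΦ₁ : ∀ t, |iteratedDeriv 1 φ t| ≤ Φ₁)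
    (hΦ₂ : ∀ t, |iteratedDeriv 2 φ t| ≤ Φ₂) (hΦ₃ : ∀ t, |iteratedDeriv 3 φ t| ≤ Φ₃) (t : ℝ) :
    |iteratedDeriv 3 (gK φ K) t| ≤ K * Φ₀ + (Φ₃ + 3 * Φ₁ + 3 * Φ₂) := by
  have h1 := abs_iteratedDeriv_gK_three_sub_le hφ hK hΦ₁ hΦ₂ hΦ₃ t
  have h2 : |K * iteratedDeriv 0 φ t * sin (K * t)| ≤ K * Φ₀ := by
    rw [abs_mul, abs_mul, abs_of_nonneg (by linarith : (0 : ℝ) ≤ K)]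
    calc K * |iteratedDeriv 0 φ t| * |sin (K * t)| ≤ K * Φ₀ * 1 :=
          mul_le_mul (mul_le_mul_of_nonneg_left (hΦ₀ t) (by linarith)) (abs_sin_le_one _)
            (abs_nonneg _) (by have := (abs_nonneg _).trans (hΦ₀ t); positivity)
      _ = K * Φ₀ := mul_one _
  have := abs_sub_abs_le_abs_sub (iteratedDeriv 3 (gK φ K) t) (K * iteratedDeriv 0 φ t * sin (K * t))
  linarith

/-- `|g_K''''| ≤ K² Φ₀ + 4K Φ₁ + Φ₄ + 6Φ₂ + 4Φ₃` for `K ≥ 1`. [folklore] -/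
theorem abs_iteratedDeriv_gK_four_le (hφ : ContDiff ℝ ∞ φ) (hK : 1 ≤ K) {Φ₀ Φ₁ Φ₂ Φ₃ Φ₄ : ℝ}
    (hΦ₀ : ∀ t, |iteratedDeriv 0 φ t| ≤ Φ₀) (hΦ₁ : ∀ t, |iteratedDeriv 1 φ t| ≤ Φ₁)
    (hΦ₂ : ∀ t, |iteratedDeriv 2 φ t| ≤ Φ₂) (hΦ₃ : ∀ t, |iteratedDeriv 3 φ t| ≤ Φ₃)
    (hΦ₄ : ∀ t, |iteratedDeriv 4 φ t| ≤ Φ₄) (t : ℝ) :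
    |iteratedDeriv 4 (gK φ K) t| ≤ K ^ 2 * Φ₀ + 4 * K * Φ₁ + (Φ₄ + 6 * Φ₂ + 4 * Φ₃) := by
  obtain ⟨h0, h1, h2⟩ := inv_sq_facts hK
  have hK0 : 0 < K := by linarith
  have hK1 : 0 < K ^ 2 := by positivity
  rw [iteratedDeriv_gK_four hφ]
  refine (abs_cos_sin_le _ _ _ _).trans ?_
  rw [abs_mul, abs_mul, abs_of_nonneg h0]
  have e0 := hΦ₀ t; have e1 := hΦ₁ t; have e2 := hΦ₂ t; have e3 := hΦ₃ t; have e4 := hΦ₄ t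
  have hP0 : 0 ≤ Φ₀ := (abs_nonneg _).trans e0
  have hP1 : 0 ≤ Φ₁ := (abs_nonneg _).trans e1
  have hP3 : 0 ≤ Φ₃ := (abs_nonneg _).trans e3
  have hA : |iteratedDeriv 4 φ t - 6 * K ^ 2 * iteratedDeriv 2 φ t + K ^ 4 * iteratedDeriv 0 φ t| ≤
      Φ₄ + 6 * K ^ 2 * Φ₂ + K ^ 4 * Φ₀ := by
    refine (abs_add_le _ _).trans (add_le_add ((abs_sub _ _).trans (add_le_add e4 ?_)) ?_)
    · rw [abs_mul, abs_of_nonneg (by positivity : (0 : ℝ) ≤ 6 * K ^ 2)]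
      exact mul_le_mul_of_nonneg_left e2 (by positivity)
    · rw [abs_mul, abs_of_nonneg (by positivity : (0 : ℝ) ≤ K ^ 4)]
      exact mul_le_mul_of_nonneg_left e0 (by positivity)
  have hB : |4 * K ^ 3 * iteratedDeriv 1 φ t - 4 * K * iteratedDeriv 3 φ t| ≤
      4 * K ^ 3 * Φ₁ + 4 * K * Φ₃ := by
    refine (abs_sub _ _).trans (add_le_add ?_ ?_)
    · rw [abs_mul, abs_of_nonneg (by positivity : (0 : ℝ) ≤ 4 * K ^ 3)]
      exact mul_le_mul_of_nonneg_left e1 (by positivity)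
    · rw [abs_mul, abs_of_nonneg (by positivity : (0 : ℝ) ≤ 4 * K)]
      exact mul_le_mul_of_nonneg_left e3 (by positivity)
  have i1 : (K ^ 2)⁻¹ * (Φ₄ + 6 * K ^ 2 * Φ₂ + K ^ 4 * Φ₀) ≤ K ^ 2 * Φ₀ + (Φ₄ + 6 * Φ₂) := by
    rw [mul_add, mul_add, show (K ^ 2)⁻¹ * (K ^ 4 * Φ₀) = K ^ 2 * Φ₀ by field_simp,
      show (K ^ 2)⁻¹ * (6 * K ^ 2 * Φ₂) = 6 * Φ₂ by field_simp]
    have : (K ^ 2)⁻¹ * Φ₄ ≤ 1 * Φ₄ := mul_le_mul_of_nonneg_right h1 ((abs_nonneg _).trans e4)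
    linarith
  have i2 : (K ^ 2)⁻¹ * (4 * K ^ 3 * Φ₁ + 4 * K * Φ₃) ≤ 4 * K * Φ₁ + 4 * Φ₃ := by
    rw [mul_add, show (K ^ 2)⁻¹ * (4 * K ^ 3 * Φ₁) = 4 * K * Φ₁ by field_simp,
      show (K ^ 2)⁻¹ * (4 * K * Φ₃) = 4 * ((K ^ 2)⁻¹ * K) * Φ₃ by ring]
    have : 4 * ((K ^ 2)⁻¹ * K) * Φ₃ ≤ 4 * 1 * Φ₃ := by gcongr
    linarith
  calc (K ^ 2)⁻¹ * |iteratedDeriv 4 φ t - 6 * K ^ 2 * iteratedDeriv 2 φ t + K ^ 4 * iteratedDeriv 0 φ t| +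
        (K ^ 2)⁻¹ * |4 * K ^ 3 * iteratedDeriv 1 φ t - 4 * K * iteratedDeriv 3 φ t|
      ≤ (K ^ 2)⁻¹ * (Φ₄ + 6 * K ^ 2 * Φ₂ + K ^ 4 * Φ₀) + (K ^ 2)⁻¹ * (4 * K ^ 3 * Φ₁ + 4 * K * Φ₃) :=
        add_le_add (mul_le_mul_of_nonneg_left hA h0) (mul_le_mul_of_nonneg_left hB h0)
    _ ≤ K ^ 2 * Φ₀ + 4 * K * Φ₁ + (Φ₄ + 6 * Φ₂ + 4 * Φ₃) := by linarith

end GK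

/-! ## `∫ Σₘ ‖∂ₘ Δ W‖²` for a general separable packet -/

section Packet

variable {φ : Fin 3 → ℝ → ℝ}

/-- The packet is supported in the closed ball of radius `4`. [folklore] -/
theorem tsupport_packet_subset (h0 : ∀ a t, 2 < |t| → φ a t = 0) :
    tsupport (packet φ) ⊆ Metric.closedBall 0 4 := by
  refine closure_minimal (fun y hy => ?_) Metric.isClosed_closedBall
  rw [Metric.mem_closedBall, dist_zero_right]
  by_contra h
  exact hy (packet_eq_zero h0 y (le_of_lt (not_le.mp h)))

/-- A linear combination of three numbers with coefficients of modulus `≤ 1` is bounded by the sum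
of the moduli. [folklore] -/
theorem abs_comb3_le {v0 v1 v2 s1 s2 s3 : ℝ} (h0 : |v0| ≤ 1) (h1 : |v1| ≤ 1) (h2 : |v2| ≤ 1) :
    |v0 * s1 + v1 * s2 + v2 * s3| ≤ |s1| + |s2| + |s3| := by
  have e1 : |v0 * s1| ≤ |s1| := by rw [abs_mul]; exact mul_le_of_le_one_left (abs_nonneg _) h0
  have e2 : |v1 * s2| ≤ |s2| := by rw [abs_mul]; exact mul_le_of_le_one_left (abs_nonneg _) h1
  have e3 : |v2 * s3| ≤ |s3| := by rw [abs_mul]; exact mul_le_of_le_one_left (abs_nonneg _) h2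
  calc |v0 * s1 + v1 * s2 + v2 * s3| ≤ |v0 * s1 + v1 * s2| + |v2 * s3| := abs_add_le _ _
    _ ≤ |v0 * s1| + |v1 * s2| + |v2 * s3| := by linarith [abs_add_le (v0 * s1) (v1 * s2)]
    _ ≤ |s1| + |s2| + |s3| := by linarith

/-- Coordinates of the unit vectors have modulus `≤ 1`. [folklore] -/
theorem abs_single_apply_le (m i : Fin 3) : |(EuclideanSpace.single m (1 : ℝ) : E3) i| ≤ 1 := by
  rw [PiLp.single_apply]; split_ifs <;> simp

/-- **Directional derivatives of `ΔW₀` and `ΔW₁`** in terms of separable monomials. [folklore] -/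
theorem fderiv_laplacian_UW (hφ : ∀ a, ContDiff ℝ ∞ (φ a)) (y v : E3) :
    fderiv ℝ (Δ (UW φ 0)) y v =
      (v 0 * sep φ 3 1 0 y + v 1 * sep φ 2 2 0 y + v 2 * sep φ 2 1 1 y) +
      (v 0 * sep φ 1 3 0 y + v 1 * sep φ 0 4 0 y + v 2 * sep φ 0 3 1 y) +
      (v 0 * sep φ 1 1 2 y + v 1 * sep φ 0 2 2 y + v 2 * sep φ 0 1 3 y) ∧
    fderiv ℝ (Δ (UW φ 1)) y v =
      -((v 0 * sep φ 4 0 0 y + v 1 * sep φ 3 1 0 y + v 2 * sep φ 3 0 1 y) +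
        (v 0 * sep φ 2 2 0 y + v 1 * sep φ 1 3 0 y + v 2 * sep φ 1 2 1 y) +
        (v 0 * sep φ 2 0 2 y + v 1 * sep φ 1 1 2 y + v 2 * sep φ 1 0 3 y)) ∧
    fderiv ℝ (Δ (UW φ 2)) y v = 0 := by
  refine ⟨?_, ?_, ?_⟩
  · rw [laplacian_UW_zero hφ]
    have h := ((hasFDerivAt_sep hφ 2 1 0 y).add (hasFDerivAt_sep hφ 0 3 0 y)).add
      (hasFDerivAt_sep hφ 0 1 2 y)
    rw [show (fun y => sep φ 2 1 0 y + sep φ 0 3 0 y + sep φ 0 1 2 y) =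
        ((fun y => sep φ 2 1 0 y + sep φ 0 3 0 y) + fun y => sep φ 0 1 2 y) from rfl]
    rw [show ((fun y => sep φ 2 1 0 y + sep φ 0 3 0 y) + fun y => sep φ 0 1 2 y) =
        (((fun y => sep φ 2 1 0 y) + fun y => sep φ 0 3 0 y) + fun y => sep φ 0 1 2 y) from rfl]
    rw [h.fderiv]
    simp only [add_apply, sepD_apply]
  · rw [laplacian_UW_one hφ]
    have h := (((hasFDerivAt_sep hφ 3 0 0 y).add (hasFDerivAt_sep hφ 1 2 0 y)).add
      (hasFDerivAt_sep hφ 1 0 2 y)).neg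
    rw [show (fun y => -(sep φ 3 0 0 y + sep φ 1 2 0 y + sep φ 1 0 2 y)) =
        -(((fun y => sep φ 3 0 0 y) + fun y => sep φ 1 2 0 y) + fun y => sep φ 1 0 2 y) from rfl]
    rw [h.fderiv]
    simp only [neg_apply, add_apply, sepD_apply]
  · rw [laplacian_UW_two, (hasFDerivAt_const (0 : ℝ) y).fderiv]; simp

/-- **Pointwise bound**: if `|sep φ i j k| ≤ 𝒮` for `i, j ≤ 4`, `k ≤ 3`, then
`Σₘ ‖∂ₘ Δ(packet φ)(y)‖² ≤ 486 𝒮²`. [folklore] -/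
theorem sum_norm_fderiv_laplacian_packet_sq_le (hφ : ∀ a, ContDiff ℝ ∞ (φ a)) {S : ℝ}
    (hS : ∀ i j k y, i ≤ 4 → j ≤ 4 → k ≤ 3 → |sep φ i j k y| ≤ S) (y : E3) :
    ∑ m : Fin 3, ‖fderiv ℝ (Δ (packet φ)) y (EuclideanSpace.single m 1)‖ ^ 2 ≤ 486 * S ^ 2 := by
  have hS0 : 0 ≤ S := (abs_nonneg _).trans (hS 0 0 0 y (by norm_num) (by norm_num) (by norm_num))
  have hΔU : ∀ i, Differentiable ℝ (Δ (UW φ i)) := fun i =>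
    (contDiff_laplacian_UW hφ i).differentiable (by simp)
  have hcomp : ∀ m : Fin 3, ‖fderiv ℝ (Δ (packet φ)) y (EuclideanSpace.single m 1)‖ ^ 2 ≤ 162 * S ^ 2 := by
    intro m
    set v : E3 := EuclideanSpace.single m 1 with hv
    have hv0 := abs_single_apply_le m 0
    have hv1 := abs_single_apply_le m 1
    have hv2 := abs_single_apply_le m 2
    obtain ⟨f0, f1, f2⟩ := fderiv_laplacian_UW hφ y v
    have hc : ∀ i, fderiv ℝ (Δ (packet φ)) y v i = fderiv ℝ (Δ (UW φ i)) y v := fun i => by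
      rw [laplacian_packet hφ, fderiv_vec3_apply hΔU]
    rw [EuclideanSpace.norm_sq_eq, Fin.sum_univ_three]
    simp only [Real.norm_eq_abs, sq_abs, hc, f0, f1, f2]
    have b := fun i j k (hi : i ≤ 4) (hj : j ≤ 4) (hk : k ≤ 3) => hS i j k y hi hj hk
    have t0 : |(v 0 * sep φ 3 1 0 y + v 1 * sep φ 2 2 0 y + v 2 * sep φ 2 1 1 y) +
        (v 0 * sep φ 1 3 0 y + v 1 * sep φ 0 4 0 y + v 2 * sep φ 0 3 1 y) +
        (v 0 * sep φ 1 1 2 y + v 1 * sep φ 0 2 2 y + v 2 * sep φ 0 1 3 y)| ≤ 9 * S := by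
      have a1 := abs_comb3_le (s1 := sep φ 3 1 0 y) (s2 := sep φ 2 2 0 y) (s3 := sep φ 2 1 1 y) hv0 hv1 hv2
      have a2 := abs_comb3_le (s1 := sep φ 1 3 0 y) (s2 := sep φ 0 4 0 y) (s3 := sep φ 0 3 1 y) hv0 hv1 hv2
      have a3 := abs_comb3_le (s1 := sep φ 1 1 2 y) (s2 := sep φ 0 2 2 y) (s3 := sep φ 0 1 3 y) hv0 hv1 hv2
      have := b 3 1 0 (by norm_num) (by norm_num) (by norm_num)
      have := b 2 2 0 (by norm_num) (by norm_num) (by norm_num)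
      have := b 2 1 1 (by norm_num) (by norm_num) (by norm_num)
      have := b 1 3 0 (by norm_num) (by norm_num) (by norm_num)
      have := b 0 4 0 (by norm_num) (by norm_num) (by norm_num)
      have := b 0 3 1 (by norm_num) (by norm_num) (by norm_num)
      have := b 1 1 2 (by norm_num) (by norm_num) (by norm_num)
      have := b 0 2 2 (by norm_num) (by norm_num) (by norm_num)
      have := b 0 1 3 (by norm_num) (by norm_num) (by norm_num)
      refine (abs_add_le _ _).trans ?_
      have := abs_add_le ((v 0 * sep φ 3 1 0 y + v 1 * sep φ 2 2 0 y + v 2 * sep φ 2 1 1 y))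
        ((v 0 * sep φ 1 3 0 y + v 1 * sep φ 0 4 0 y + v 2 * sep φ 0 3 1 y))
      linarith
    have t1 : |-((v 0 * sep φ 4 0 0 y + v 1 * sep φ 3 1 0 y + v 2 * sep φ 3 0 1 y) +
        (v 0 * sep φ 2 2 0 y + v 1 * sep φ 1 3 0 y + v 2 * sep φ 1 2 1 y) +
        (v 0 * sep φ 2 0 2 y + v 1 * sep φ 1 1 2 y + v 2 * sep φ 1 0 3 y))| ≤ 9 * S := by
      rw [abs_neg]
      have a1 := abs_comb3_le (s1 := sep φ 4 0 0 y) (s2 := sep φ 3 1 0 y) (s3 := sep φ 3 0 1 y) hv0 hv1 hv2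
      have a2 := abs_comb3_le (s1 := sep φ 2 2 0 y) (s2 := sep φ 1 3 0 y) (s3 := sep φ 1 2 1 y) hv0 hv1 hv2
      have a3 := abs_comb3_le (s1 := sep φ 2 0 2 y) (s2 := sep φ 1 1 2 y) (s3 := sep φ 1 0 3 y) hv0 hv1 hv2
      have := b 4 0 0 (by norm_num) (by norm_num) (by norm_num)
      have := b 3 1 0 (by norm_num) (by norm_num) (by norm_num)
      have := b 3 0 1 (by norm_num) (by norm_num) (by norm_num)
      have := b 2 2 0 (by norm_num) (by norm_num) (by norm_num)
      have := b 1 3 0 (by norm_num) (by norm_num) (by norm_num)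
      have := b 1 2 1 (by norm_num) (by norm_num) (by norm_num)
      have := b 2 0 2 (by norm_num) (by norm_num) (by norm_num)
      have := b 1 1 2 (by norm_num) (by norm_num) (by norm_num)
      have := b 1 0 3 (by norm_num) (by norm_num) (by norm_num)
      refine (abs_add_le _ _).trans ?_
      have := abs_add_le ((v 0 * sep φ 4 0 0 y + v 1 * sep φ 3 1 0 y + v 2 * sep φ 3 0 1 y))
        ((v 0 * sep φ 2 2 0 y + v 1 * sep φ 1 3 0 y + v 2 * sep φ 1 2 1 y))
      linarith
    have sq0 := sq_le_sq' (abs_le.mp t0).1 (abs_le.mp t0).2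
    have sq1 := sq_le_sq' (abs_le.mp t1).1 (abs_le.mp t1).2
    nlinarith
  calc ∑ m : Fin 3, ‖fderiv ℝ (Δ (packet φ)) y (EuclideanSpace.single m 1)‖ ^ 2
      ≤ ∑ _m : Fin 3, 162 * S ^ 2 := Finset.sum_le_sum fun m _ => hcomp m
    _ = 486 * S ^ 2 := by simp; ring

/-- **`∫ Σₘ ‖∂ₘ ΔW‖² ≤ 486 𝒮² |B̄(0,4)|`** for a separable packet with profiles vanishing off
`[-2,2]` and `|sep φ i j k| ≤ 𝒮` (`i, j ≤ 4`, `k ≤ 3`). [folklore] -/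
theorem packet_gradLaplacianNormSq_le (hφ : ∀ a, ContDiff ℝ ∞ (φ a)) (h0 : ∀ a t, 2 < |t| → φ a t = 0)
    {S : ℝ} (hS : ∀ i j k y, i ≤ 4 → j ≤ 4 → k ≤ 3 → |sep φ i j k y| ≤ S) :
    (∫ y, ∑ m : Fin 3, ‖fderiv ℝ (Δ (packet φ)) y (EuclideanSpace.single m 1)‖ ^ 2) ≤
      486 * S ^ 2 * volBall 4 :=
  integral_le_of_le_of_ball (fun y => Finset.sum_nonneg fun _ _ => sq_nonneg _)
    (sum_norm_fderiv_laplacian_packet_sq_le hφ hS) fun y hy => by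
      have h1 : y ∉ tsupport (Δ (packet φ)) := fun h => by
        have := tsupport_packet_subset h0 (tsupport_laplacian_subset' _ h)
        rw [Metric.mem_closedBall, dist_zero_right] at this
        linarith
      simp [fderiv_of_notMem_tsupport ℝ h1]

end Packet

end Sep3

end Summit.NavierStokesRegularity.FunctionalMining

end
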